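import Summits.CriticalPhenomena.CardyFormulaZ2.Theorems.CardyFlipRussoVoronoiHubFromSmirnovOneArmScales
import Summits.CriticalPhenomena.CardyFormulaZ2.Theorems.CardyFlipRussoVoronoiHubFromSmirnovTendstoLogPow
import Mathlib.Analysis.Real.Sqrt
import Mathlib.Analysis.SpecialFunctions.Pow.Real
import Mathlib.Analysis.Complex.Exponential
import Mathlib.Topology.Order.OrderClosed
import HarnessLib

/-!
# Stub `scales_eventually` of line `moebius-exact-delaunay-dilation-ward`
# (crux `VoronoiHubFromSmirnov`, stmt-CriticalPhenomena-6433)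

The side conditions under which the deterministic and probabilistic bricks of the one-arm route
apply at mesh `δ`: for fixed constants (`Λ ≥ 1`, `W W' r_b r_g r_f r_h ℓ₀ ℓ₀' η s₀ m₁ D₀ > 0`),
EVENTUALLY as `δ → 0⁺` a conjunction of elementary inequalities holds, all involving only `δ`, the
no-void radius `rvS δ = 6 √|log δ|`, the near-tie tolerances `τS W δ = W δ² (2 rvS δ)³`,
`τS' W' Λ δ = W' δ² (2 Λ rvS δ)³` and the arm radius `RS δ = (√δ)⁻¹`.

Proof.  Three primitive limits as `δ → 0⁺` — `δ · rvS δ → 0`, `√δ · rvS δ → 0` (both from the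
landed bookkeeping limit `tendsto_const_mul_log_pow_mul_rpow`, since `δ rvS δ = 6 √(|log δ| δ²)`
and `√δ rvS δ = 6 √(|log δ| δ)`) and `√δ → 0` — give, for every coefficient `a` and every `c > 0`,
the eventual inequalities `a · (δ rvS δ) ≤ c`, `a · (√δ rvS δ) ≤ c`, `√δ ≤ c`; moreover
`δ < e⁻¹` eventually, whence `|log δ| ≥ 1` and `rvS δ ≥ 6`.  Each conjunct is then a linear
combination of finitely many of these facts (after multiplying through by `δ > 0` for the
conjuncts with `/ δ`, and after the pointwise algebraic step
`a δ² r³ ≤ c r ⇐ a (δ r) ≤ c ∧ δ r ≤ 1`, used for the `τS`, `τS'` conjuncts).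
Elementary real analysis (Mathlib only); no new definitions, no named facts.
-/

noncomputable section

namespace Summit.CriticalPhenomena.CardyFormulaZ2.Cruxes.VoronoiHubFromSmirnov.MoebiusExactDelaunayDilationWard

open Filter
open scoped Topology

/-- `δ · rvS δ → 0` as `δ → 0⁺` (since `δ · rvS δ = 6 √(|log δ| · δ²)` for `δ > 0`). [folklore] -/
theorem se_tendsto_mul_rvS : Tendsto (fun δ : ℝ => δ * rvS δ) (𝓝[>] 0) (𝓝 0) := by
  have h := ((tendsto_const_mul_log_pow_mul_rpow 1 2 1 (by norm_num)).sqrt).const_mul 6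
  rw [Real.sqrt_zero, mul_zero] at h
  refine h.congr' ?_
  filter_upwards [self_mem_nhdsWithin] with δ hδ
  rw [Set.mem_Ioi] at hδ
  rw [one_mul, pow_one, Real.sqrt_mul (abs_nonneg _), Real.rpow_two, Real.sqrt_sq hδ.le, rvS]
  ring

/-- `√δ · rvS δ → 0` as `δ → 0⁺` (since `√δ · rvS δ = 6 √(|log δ| · δ)` for `δ > 0`). [folklore] -/
theorem se_tendsto_sqrt_mul_rvS :
    Tendsto (fun δ : ℝ => Real.sqrt δ * rvS δ) (𝓝[>] 0) (𝓝 0) := by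
  have h := ((tendsto_const_mul_log_pow_mul_rpow 1 1 1 one_pos).sqrt).const_mul 6
  rw [Real.sqrt_zero, mul_zero] at h
  refine h.congr' ?_
  filter_upwards [self_mem_nhdsWithin] with δ hδ
  rw [one_mul, pow_one, Real.rpow_one, Real.sqrt_mul (abs_nonneg _), rvS]
  ring

/-- `√δ → 0` as `δ → 0⁺`. [folklore] -/
theorem se_tendsto_sqrt : Tendsto (fun δ : ℝ => Real.sqrt δ) (𝓝[>] 0) (𝓝 0) := by
  have h := Real.continuous_sqrt.tendsto 0
  rw [Real.sqrt_zero] at h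
  exact tendsto_nhdsWithin_of_tendsto_nhds h

/-- If `f δ → 0` as `δ → 0⁺`, then for every coefficient `a` and every `c > 0`, eventually
`a · f δ ≤ c`. [folklore] -/
theorem se_eventually_mul_le {f : ℝ → ℝ} (h : Tendsto f (𝓝[>] 0) (𝓝 0)) (a c : ℝ)
    (hc : 0 < c) : ∀ᶠ δ : ℝ in 𝓝[>] 0, a * f δ ≤ c := by
  have h' := h.const_mul a
  rw [mul_zero] at h'
  exact h'.eventually (eventually_le_nhds hc)

/-- Eventually `a · (δ · rvS δ) ≤ c`, for every `a` and every `c > 0`. [folklore] -/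
theorem se_ev_mul_rvS_le (a c : ℝ) (hc : 0 < c) :
    ∀ᶠ δ : ℝ in 𝓝[>] 0, a * (δ * rvS δ) ≤ c :=
  se_eventually_mul_le se_tendsto_mul_rvS a c hc

/-- Eventually `a · (√δ · rvS δ) ≤ c`, for every `a` and every `c > 0`. [folklore] -/
theorem se_ev_sqrt_mul_rvS_le (a c : ℝ) (hc : 0 < c) :
    ∀ᶠ δ : ℝ in 𝓝[>] 0, a * (Real.sqrt δ * rvS δ) ≤ c :=
  se_eventually_mul_le se_tendsto_sqrt_mul_rvS a c hc

/-- Eventually `√δ ≤ c`, for every `c > 0`. [folklore] -/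
theorem se_ev_sqrt_le (c : ℝ) (hc : 0 < c) : ∀ᶠ δ : ℝ in 𝓝[>] 0, Real.sqrt δ ≤ c := by
  filter_upwards [se_eventually_mul_le se_tendsto_sqrt 1 c hc] with δ h
  linarith

/-- Eventually `δ < e⁻¹` as `δ → 0⁺`. [folklore] -/
theorem se_ev_lt_exp_neg_one : ∀ᶠ δ : ℝ in 𝓝[>] 0, δ < Real.exp (-1) :=
  eventually_nhdsWithin_of_eventually_nhds (eventually_lt_nhds (Real.exp_pos (-1)))

/-- For `0 < δ < e⁻¹` the no-void radius satisfies `6 ≤ rvS δ`. [folklore] -/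
theorem se_six_le_rvS {δ : ℝ} (hδ : 0 < δ) (hE : δ < Real.exp (-1)) : 6 ≤ rvS δ := by
  have hlog : Real.log δ < -1 := by
    have := Real.log_lt_log hδ hE
    rwa [Real.log_exp] at this
  have habs : 1 ≤ |Real.log δ| := by
    rw [abs_of_neg (by linarith)]
    linarith
  have h1 : Real.sqrt 1 ≤ Real.sqrt |Real.log δ| := Real.sqrt_le_sqrt habs
  rw [Real.sqrt_one] at h1
  unfold rvS
  linarith

/-- Pointwise algebra for the `τS`, `τS'` conjuncts: `a δ² r³ ≤ c r` once `a (δ r) ≤ c` and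
`δ r ≤ 1` (all quantities nonnegative). [folklore] -/
theorem se_aux_sq (a δ r c : ℝ) (ha : 0 ≤ a) (hδ : 0 ≤ δ) (hr : 0 ≤ r) (hx1 : δ * r ≤ 1)
    (hax : a * (δ * r) ≤ c) : a * δ ^ 2 * r ^ 3 ≤ c * r := by
  have hx0 : 0 ≤ δ * r := mul_nonneg hδ hr
  have hc : 0 ≤ c := le_trans (mul_nonneg ha hx0) hax
  have h1 : a * (δ * r) ^ 2 ≤ c := by
    calc a * (δ * r) ^ 2 = a * (δ * r) * (δ * r) := by ring
      _ ≤ c * 1 := mul_le_mul hax hx1 hx0 hc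
      _ = c := mul_one c
  calc a * δ ^ 2 * r ^ 3 = a * (δ * r) ^ 2 * r := by ring
    _ ≤ c * r := mul_le_mul_of_nonneg_right h1 hr

/-- **Side conditions of the one-arm route, eventually in the mesh** (registered stub of the
crux): for fixed constants `Λ ≥ 1` and `W, W', r_b, r_g, r_f, r_h, ℓ₀, ℓ₀', η, s₀, m₁, D₀ > 0`,
eventually as `δ → 0⁺` all the elementary inequalities between `δ`, `rvS δ`, `τS W δ`,
`τS' W' Λ δ` and `RS δ` used by the final assembly hold simultaneously. -/
theorem scales_eventually : ∀ (Λ W W' r_b r_g r_f r_h ℓ₀ ℓ₀' η s₀ m₁ D₀ : ℝ), 1 ≤ Λ → 0 < W → 0 < W' → 0 < r_b → 0 < r_g → 0 < r_f → 0 < r_h → 0 < ℓ₀ → 0 < ℓ₀' → 0 < η → 0 < s₀ → 0 < m₁ → 0 < D₀ → ∀ᶠ δ : ℝ in nhdsWithin 0 (Set.Ioi 0), 0 < δ ∧ δ < 1 ∧ 1 ≤ rvS δ ∧ 6 * rvS δ ≤ s₀ / δ ∧ 5 * Λ ^ 3 * rvS δ ≤ s₀ / δ ∧ 8 * (δ *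 rvS δ) ≤ r_g ∧ 8 * Λ * (δ * rvS δ) ≤ r_f ∧ δ * (2 * rvS δ) ≤ ℓ₀ ∧ δ * (2 * Λ * rvS δ) ≤ ℓ₀' ∧ δ * (2 * Λ * rvS δ) < η ∧ δ * (Λ ^ 2 * (4 * Λ * rvS δ) + rvS δ) ≤ r_b ∧ Λ ^ 2 * (4 * Λ * rvS δ) + rvS δ ≤ m₁ / δ - rvS δ ∧ δ * (10 * Λ ^ 3 * rvS δ) ≤ r_b ∧ τS W δ ≤ 2 * rvS δ ∧ τS' W' Λ δ ≤ 2 * Λ * rvS δ ∧ 10 * Λ ^ 3 * rvS δ + Λ * (3 * (2 * Λ * rvS δ) + τS' W' Λ δ) ≤ 2 * (10 * Λ ^ 3 * rvS δ) ∧ 10 * Λ ^ 3 * rvS δ + 6 * rvS δ + τS W δ ≤ 2 * (10 * Λ ^ 3 * rvS δ) ∧ 400 * (10 * Λ ^ 3 * rvS δ) < RS δ ∧ RS δ ≤ D₀ / δ ∧ 1 ≤ 100 * (10 * Λ ^ 3 * rvS δ) ∧ 0 < τS W δ ∧ 0 < τS' W' Λ δ ∧ δ * (RS δ + 9 * (10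 * Λ ^ 3 * rvS δ)) ≤ m₁ / 3 ∧ δ * (2 * (10 * Λ ^ 3 * rvS δ)) ≤ r_h := by
  intro Λ W W' r_b r_g r_f r_h ℓ₀ ℓ₀' η s₀ m₁ D₀ hΛ hW hW' hr_b hr_g hr_f hr_h hℓ₀ hℓ₀' hη hs₀ hm₁ hD₀
  have hΛ0 : 0 < Λ := by linarith
  have hΛ3 : 1 ≤ Λ ^ 3 := one_le_pow₀ hΛ
  have hexp1 : Real.exp (-1) < 1 := Real.exp_lt_one_iff.mpr (by norm_num)
  filter_upwards [self_mem_nhdsWithin, se_ev_lt_exp_neg_one,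
    se_ev_mul_rvS_le 6 s₀ hs₀, se_ev_mul_rvS_le (5 * Λ ^ 3) s₀ hs₀, se_ev_mul_rvS_le 8 r_g hr_g,
    se_ev_mul_rvS_le (8 * Λ) r_f hr_f, se_ev_mul_rvS_le 2 ℓ₀ hℓ₀, se_ev_mul_rvS_le (2 * Λ) ℓ₀' hℓ₀',
    se_ev_mul_rvS_le (2 * Λ) (η / 2) (by positivity), se_ev_mul_rvS_le (4 * Λ ^ 3 + 1) r_b hr_b,
    se_ev_mul_rvS_le (4 * Λ ^ 3 + 2) m₁ hm₁, se_ev_mul_rvS_le (10 * Λ ^ 3) r_b hr_b,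
    se_ev_mul_rvS_le (20 * Λ ^ 3) r_h hr_h, se_ev_mul_rvS_le (90 * Λ ^ 3) (m₁ / 6) (by positivity),
    se_ev_mul_rvS_le 1 1 one_pos, se_ev_mul_rvS_le W (1 / 4) (by norm_num),
    se_ev_mul_rvS_le (W' * Λ ^ 3) (Λ / 4) (by positivity),
    se_ev_mul_rvS_le (W' * Λ ^ 4) (Λ ^ 3 / 2) (by positivity),
    se_ev_sqrt_mul_rvS_le (400 * (10 * Λ ^ 3)) (1 / 2) (by norm_num), se_ev_sqrt_le D₀ hD₀,
    se_ev_sqrt_le (m₁ / 6) (by positivity)]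
    with δ hδ hE h4 h5 h6 h7 h8 h9 h10 h11 h12 h13 h24 h23 hx1 h14 h15 h16 h18 h19 h23'
  rw [Set.mem_Ioi] at hδ
  have hδ1 : δ < 1 := hE.trans hexp1
  have hr6 : 6 ≤ rvS δ := se_six_le_rvS hδ hE
  have hr0 : 0 < rvS δ := by linarith
  have hΛ23 : Λ ^ 2 * rvS δ ≤ Λ ^ 3 * rvS δ :=
    mul_le_mul_of_nonneg_right (pow_le_pow_right₀ hΛ (by norm_num)) hr0.le
  have hΛ3r : rvS δ ≤ Λ ^ 3 * rvS δ := le_mul_of_one_le_left hr0.le hΛ3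
  have hsq0 : 0 < Real.sqrt δ := Real.sqrt_pos.mpr hδ
  have hRS : δ * RS δ = Real.sqrt δ := by
    rw [RS, ← div_eq_mul_inv, Real.div_sqrt]
  have hx1' : δ * rvS δ ≤ 1 := by linarith
  have a14 : W * δ ^ 2 * rvS δ ^ 3 ≤ 1 / 4 * rvS δ :=
    se_aux_sq W δ (rvS δ) (1 / 4) hW.le hδ.le hr0.le hx1' h14
  have a15 : W' * Λ ^ 3 * δ ^ 2 * rvS δ ^ 3 ≤ Λ / 4 * rvS δ :=
    se_aux_sq (W' * Λ ^ 3) δ (rvS δ) (Λ / 4) (by positivity) hδ.le hr0.le hx1' h15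
  have a16 : W' * Λ ^ 4 * δ ^ 2 * rvS δ ^ 3 ≤ Λ ^ 3 / 2 * rvS δ :=
    se_aux_sq (W' * Λ ^ 4) δ (rvS δ) (Λ ^ 3 / 2) (by positivity) hδ.le hr0.le hx1' h16
  refine ⟨hδ, hδ1, by linarith, ?_, ?_, h6, h7, by linarith, by linarith, by linarith, by linarith,
    ?_, by linarith, ?_, ?_, ?_, ?_, ?_, ?_, by linarith, ?_, ?_, ?_, by linarith⟩
  · -- `6 * rvS δ ≤ s₀ / δ`
    rw [le_div_iff₀ hδ]
    linarith
  · -- `5 * Λ ^ 3 * rvS δ ≤ s₀ / δ`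
    rw [le_div_iff₀ hδ]
    linarith
  · -- `Λ ^ 2 * (4 * Λ * rvS δ) + rvS δ ≤ m₁ / δ - rvS δ`
    rw [le_sub_iff_add_le, le_div_iff₀ hδ]
    linarith
  · -- `τS W δ ≤ 2 * rvS δ`
    unfold τS
    linarith
  · -- `τS' W' Λ δ ≤ 2 * Λ * rvS δ`
    unfold τS'
    linarith
  · -- `10 Λ³ rvS + Λ (6 Λ rvS + τS') ≤ 20 Λ³ rvS`
    unfold τS'
    linarith
  · -- `10 Λ³ rvS + 6 rvS + τS ≤ 20 Λ³ rvS`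
    unfold τS
    linarith
  · -- `400 * (10 * Λ ^ 3 * rvS δ) < RS δ`
    rw [RS, inv_eq_one_div, lt_div_iff₀ hsq0]
    linarith
  · -- `RS δ ≤ D₀ / δ`
    rw [le_div_iff₀ hδ, mul_comm, hRS]
    exact h19
  · -- `0 < τS W δ`
    unfold τS
    positivity
  · -- `0 < τS' W' Λ δ`
    unfold τS'
    positivity
  · -- `δ * (RS δ + 9 * (10 * Λ ^ 3 * rvS δ)) ≤ m₁ / 3`
    rw [mul_add, hRS]
    linarith

end Summit.CriticalPhenomena.CardyFormulaZ2.Cruxes.VoronoiHubFromSmirnov.MoebiusExactDelaunayDilationWard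

end
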